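import Summits.CriticalPhenomena.PercolationContinuityZ3.Theorems.Transplant.PlanarSkeletonFrmFromDefs
import Summits.CriticalPhenomena.PercolationContinuityZ3.Theorems.Transplant.SkelFrmFromBChoiceCreepY3
import Summits.CriticalPhenomena.PercolationContinuityZ3.Theorems.Transplant.SkelFrmBChoiceCreepY3
import Summits.CriticalPhenomena.PercolationContinuityZ3.Theorems.Transplant.SkelFrmBChoiceRegionsYCore3
import Summits.CriticalPhenomena.PercolationContinuityZ3.Theorems.Transplant.SkelPhiCorridorKGYRegions
import Summits.CriticalPhenomena.PercolationContinuityZ3.Theorems.Transplant.SkelPhiNegReachReadBK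
import HarnessLib
import Summits.CriticalPhenomena.PercolationContinuityZ3.Theorems.Transplant.SkelFrmBChoiceRegionsYW
/-!
# U-WAVE PORT (RULING D-U, lead g21 2026-08-26; WAVE-U-MANIFEST v3.0 row «SkelFrmBChoiceRegionsYW» ↦ «SkelFrmFromBChoiceRegionsYW») of the tree module
# `Transplant/SkelFrmBChoiceRegionsYW` onto the carrier `PlanarSkeletonFrmFrom` (frames only, cylinders connected from width `ℓ₀` on)

ORIGINAL TITLE: N2 (frames-only node `SamePDropOfSkeletonFrm₁`, OPEN) — (ζ″) at the (R-45) instance of record `BSlot.small3 = (76·s₀, 19·s₁)`: THE y′-CORRIDOR's PER-REGION READING ROWS at the tuple of record, `NegB.hPRY_W` —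

builds on p205010 (kernel theorem, internal audit signed; external expert review pending) — nothing in this file uses p205010; NOTHING is claimed about the
OPEN node U `SamePDropOfSkeletonFrmFrom₁` (nor U_s / the end state).  Lane `prim-bschramm`, seat `prim-hp-8 gen 53 (U-wave port pen, family P-hp8; tool of record = p3-g26 port_u.py)`; helper file
(`--supports stmt-CriticalPhenomena-4575 --as helper`).  PORT RULES r1–r4 of RULING D-U: declaration order and proof texts are those of the original,
byte-identical except (i) the carrier token `PlanarSkeletonFrm ↦ PlanarSkeletonFrmFrom` (binders, `namespace`/`end` lines, qualified names of twinned
declarations), (ii) carrier-FREE declarations of the original (φ-level `Skelφ…` blocks and namespace-only arithmetic residents) are NOT re-declared —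
this file imports the original and `export`s the twin-free residents (POLICY T / treatment (m1)); residents whose statement mentions a twinned
constant are copied, (iii) every carrier-binding declaration keeps its explicit binder `(Φ : PlanarSkeletonFrmFrom G)` in its own signature (r2).  Docstrings and citations are the original's.  Manifest row idx 142 (level 17; flags verbatim); filed by the hp-8 lineage under RULING M-11 (family P-hp8); hidden-dependency repairs: extra twin imports -; re-pointing opens ['--open-extra', 'PlanarSkeletonFrm.NegB=regionY_core3'] (M-4).
-/

open scoped Classical

noncomputable section

namespace Summit.CriticalPhenomena.PercolationContinuityZ3.Theorems.Transplant

namespace PlanarSkeletonFrmFrom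

open PlanarSkeletonFrm.NegB (regionY_core3)

namespace NegB

open Literature.Probability.Percolation Literature.Probability.LatticeModels SimpleGraph
open SkelConc (Consts)
open Skelφ (shearUnit kgSL kgSLY kgM₁Y kgM₂Y kgE₁Y kgWm₂Y kgWp₂Y kgA₁Yp kgA₁Ym kgC₂Y dS rdLo rdHi KGYRows)
open TwoAxis.Para (modulus)
open Neg

section RegionsY

variable (κ : Consts) {V : Type} [DecidableEq V] [Countable V] {G : SimpleGraph V} [G.LocallyFinite] (Φ : PlanarSkeletonFrmFrom G) (t : V) (p : unitInterval)
  (D : Skelφ.StepI.DataNS V) (g f mk : ℕ)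

/- The tuple's atoms as hygiene-free local notations (they expand syntactically at each use; importers see the expanded terms; `HKᵣ` mentions the
   binders `hN hg` of the theorem it is used in). -/
set_option hygiene false in local notation "NYᵣ" => kgNYv0 κ Φ t p D g f mk (qxYQ4 κ Φ t p D g f) (WxYQ4 κ Φ t p D g f)
set_option hygiene false in local notation "qYᵣ" => kgqY κ Φ t p D g f (qxYQ4 κ Φ t p D g f)
set_option hygiene false in local notation "WYᵣ" => kgWY κ Φ t p D g f (WxYQ4 κ Φ t p D g f)
set_option hygiene false in local notation "Rᵣ" => kgR κ Φ t p D mk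
set_option hygiene false in local notation "nᵣ" => nL κ Φ t p D g f
set_option hygiene false in local notation "ℓᵣ" => ℓL κ Φ t p D g f
set_option hygiene false in local notation "hᵣ" => hL κ Φ t p D g f
set_option hygiene false in local notation "vᵣ" => vL κ Φ t p D g f
set_option hygiene false in local notation "Uᵣ" => shearUnit (nL κ Φ t p D g f) (hL κ Φ t p D g f)
set_option hygiene false in local notation "Δᵣ" => modulus (nL κ Φ t p D g f) (hL κ Φ t p D g f) (vL κ Φ t p D g f) (vβL κ Φ t p D g f)
set_option hygiene false in local notation "sLᵣ" => kgSL (nL κ Φ t p D g f) (ℓL κ Φ t p D g f) (hL κ Φ t p D g f)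
set_option hygiene false in local notation "s0ᵣ" => (((fcellsA κ Φ t p D g f).s 0 : ℕ) : ℤ)
set_option hygiene false in local notation "s1ᵣ" => (((fcellsA κ Φ t p D g f).s 1 : ℕ) : ℤ)
set_option hygiene false in local notation "r0ᵣ" => (((fcellsA κ Φ t p D g f).r 0 : ℕ) : ℤ)
set_option hygiene false in local notation "r1ᵣ" => (((fcellsA κ Φ t p D g f).r 1 : ℕ) : ℤ)
set_option hygiene false in local notation "Kᵣ" => ((Neg.K κ : ℕ) : ℤ)
set_option hygiene false in local notation "kqᵣ" => ((Neg.Kq κ : ℕ) : ℤ)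
set_option hygiene false in local notation "m1ᵣ" => kgM₁Y (nL κ Φ t p D g f) (vL κ Φ t p D g f) (kgR κ Φ t p D mk) 0 (kgWY κ Φ t p D g f (WxYQ4 κ Φ t p D g f)) (kgNYv0 κ Φ t p D g f mk (qxYQ4 κ Φ t p D g f) (WxYQ4 κ Φ t p D g f))
set_option hygiene false in local notation "m2ᵣ" => kgM₂Y (nL κ Φ t p D g f) (ℓL κ Φ t p D g f) (hL κ Φ t p D g f) (vL κ Φ t p D g f) (kgR κ Φ t p D mk) 0 (kgqY κ Φ t p D g f (qxYQ4 κ Φ t p D g f)) (kgWY κ Φ t p D g f (WxYQ4 κ Φ t p D g f)) (kgNYv0 κ Φ t p D g f mk (qxYQ4 κ Φ t p D g f) (WxYQ4 κ Φ t p D g f))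
set_option hygiene false in local notation "Wm2ᵣ" => kgWm₂Y (nL κ Φ t p D g f) (vL κ Φ t p D g f) (kgR κ Φ t p D mk) 0 (kgWY κ Φ t p D g f (WxYQ4 κ Φ t p D g f)) (kgNYv0 κ Φ t p D g f mk (qxYQ4 κ Φ t p D g f) (WxYQ4 κ Φ t p D g f))
set_option hygiene false in local notation "Wp2ᵣ" => kgWp₂Y (nL κ Φ t p D g f) (vL κ Φ t p D g f) (kgR κ Φ t p D mk) 0 (kgWY κ Φ t p D g f (WxYQ4 κ Φ t p D g f)) (kgNYv0 κ Φ t p D g f mk (qxYQ4 κ Φ t p D g f) (WxYQ4 κ Φ t p D g f))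
set_option hygiene false in local notation "HKᵣ" => kgYRows0_of κ Φ t p D g f mk (qxYQ4 κ Φ t p D g f) (WxYQ4 κ Φ t p D g f) hN hg
set_option hygiene false in local notation "rdLoᵣ" => rdLo (Aof κ) (nL κ Φ t p D g f) (hL κ Φ t p D g f) (vL κ Φ t p D g f) (vβL κ Φ t p D g f) (prFA κ Φ t p D g f).c₀ (prFA κ Φ t p D g f).c₁ (prFA κ Φ t p D g f).D
set_option hygiene false in local notation "rdHiᵣ" => rdHi (Aof κ) (nL κ Φ t p D g f) (hL κ Φ t p D g f) (vL κ Φ t p D g f) (vβL κ Φ t p D g f) (prFA κ Φ t p D g f).c₀ (prFA κ Φ t p D g f).c₁ (prFA κ Φ t p D g f).D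
set_option hygiene false in local notation "L3ᵣ" => ((3 * (nL κ Φ t p D g f * ℓL κ Φ t p D g f) / shearUnit (nL κ Φ t p D g f) (hL κ Φ t p D g f) + 1 : ℕ) : ℤ)
set_option hygiene false in local notation "P0ᵣ" => ((nL κ Φ t p D g f : ℕ) : ℤ) * ℓL κ Φ t p D g f / (shearUnit (nL κ Φ t p D g f) (hL κ Φ t p D g f) : ℕ)
set_option hygiene false in local notation "dSᵣ" => (((dS (nL κ Φ t p D g f) (ℓL κ Φ t p D g f) (hL κ Φ t p D g f) : ℕ)) : ℤ)
set_option hygiene false in local notation "Apᵣ" => ((kgA₁Yp (nL κ Φ t p D g f) (vL κ Φ t p D g f) (kgR κ Φ t p D mk) (kgWY κ Φ t p D g f (WxYQ4 κ Φ t p D g f)) (kgNYv0 κ Φ t p D g f mk (qxYQ4 κ Φ t p D g f) (WxYQ4 κ Φ t p D g f)) : ℕ) : ℤ)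
set_option hygiene false in local notation "Amᵣ" => ((kgA₁Ym (nL κ Φ t p D g f) (vL κ Φ t p D g f) (kgR κ Φ t p D mk) (kgWY κ Φ t p D g f (WxYQ4 κ Φ t p D g f)) (kgNYv0 κ Φ t p D g f mk (qxYQ4 κ Φ t p D g f) (WxYQ4 κ Φ t p D g f)) : ℕ) : ℤ)
set_option hygiene false in local notation "SCHᵣ" => Skelφ.kgCorrSchedY (HKᵣ).hn (HKᵣ).hv (HKᵣ).hlay ((HKᵣ).kgYVals_ok₁ NYᵣ) ((HKᵣ).kgYVals_ok₂ NYᵣ) ((HKᵣ).kgYVals_split NYᵣ)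

/-- **THE TUPLE's NUMBERS FOR THE REGION BOXES** (one conjunction, read once per region type). [this work] -/
theorem regionY_facts_W (κ : Consts) {V : Type} [DecidableEq V] [Countable V] {G : SimpleGraph V} [G.LocallyFinite] (Φ : PlanarSkeletonFrmFrom G) (t : V) (p : unitInterval) (D : Skelφ.StepI.DataNS V) (g : ℕ) (f : ℕ) (mk : ℕ) (hKq : 5 ≤ Neg.Kq κ) (hN : EqNumL κ Φ t p D g f) (hg : gFloorKG κ Φ t p D mk ≤ g) (hg2 : 40 * Neg.K κ * KS0.R'0 κ Φ t p D mk ≤ g) :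
    1 ≤ ((Uᵣ : ℕ) : ℤ) ∧ 958 ≤ sLᵣ ∧ ((Uᵣ : ℕ) : ℤ) * sLᵣ ≤ Δᵣ ∧ Δᵣ ≤ ((Uᵣ : ℕ) : ℤ) * sLᵣ + 2 * ((Uᵣ : ℕ) : ℤ) ∧ 1 ≤ ((nᵣ : ℕ) : ℤ) ∧ |vᵣ| ≤ ((nᵣ : ℕ) : ℤ) ∧ 5 ≤ kqᵣ ∧ 1 ≤ s0ᵣ ∧ 1 ≤ s1ᵣ ∧
      r0ᵣ = 40 * kqᵣ * s0ᵣ ∧ r1ᵣ = 40 * kqᵣ * s1ᵣ ∧ ((NYᵣ : ℕ) : ℤ) + 1 ≤ 840 * kqᵣ + 3 ∧ (((NYᵣ : ℕ) : ℤ) + 1) * ((Rᵣ : ℕ) : ℤ) + 1 ≤ ((nᵣ : ℕ) : ℤ) ∧ (((NYᵣ : ℕ) : ℤ) + 1) * ((Rᵣ : ℕ) : ℤ) ≤ sLᵣ + 1 ∧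
      ((WYᵣ : ℕ) : ℤ) = 98 * ((nᵣ : ℕ) : ℤ) ∧ (((((nᵣ : ℕ) : ℤ) + vᵣ).toNat : ℕ) : ℤ) = ((nᵣ : ℕ) : ℤ) + vᵣ ∧ (((((nᵣ : ℕ) : ℤ) - vᵣ).toNat : ℕ) : ℤ) = ((nᵣ : ℕ) : ℤ) - vᵣ ∧
      ((qYᵣ : ℕ) : ℤ) = P0ᵣ + 1 + 19 * sLᵣ + 42 ∧ 3 * (((nᵣ : ℕ) : ℤ) * ℓᵣ) / (Uᵣ : ℕ) + 1 ≤ 3 * sLᵣ + 6 ∧ sLᵣ ≤ P0ᵣ ∧ P0ᵣ ≤ sLᵣ + 1 ∧ dSᵣ ≤ 2 ∧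
      ((m1ᵣ : ℕ) : ℤ) + 1 ≤ 198 ∧ ((m2ᵣ : ℕ) : ℤ) + 1 ≤ 42 ∧ ((Wm2ᵣ : ℕ) : ℤ) + ((Wp2ᵣ : ℕ) : ℤ) ≤ 5 * ((nᵣ : ℕ) : ℤ) ∧ 241 * ((Rᵣ : ℕ) : ℤ) + 1 ≤ ((nᵣ : ℕ) : ℤ) ∧
      241 * ((Rᵣ : ℕ) : ℤ) ≤ sLᵣ + 1 ∧ 40 * Kᵣ ≤ sLᵣ + 1 ∧ Kᵣ = 40 * kqᵣ ∧ 0 ≤ ((Rᵣ : ℕ) : ℤ) ∧ (((nᵣ : ℕ) : ℤ) * ℓᵣ - (Uᵣ : ℕ) + 1) / (Uᵣ : ℕ) = sLᵣ ∧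
      vᵣ ≤ ((nᵣ : ℕ) : ℤ) ∧ -((nᵣ : ℕ) : ℤ) ≤ vᵣ ∧ (((NYᵣ : ℕ) : ℤ) + 1) * dSᵣ ≤ (((NYᵣ : ℕ) : ℤ) + 1) * 2 ∧ 0 ≤ 3 * (((nᵣ : ℕ) : ℤ) * ℓᵣ) / (Uᵣ : ℕ) + 1 ∧ 0 ≤ (((NYᵣ : ℕ) : ℤ) + 1) * dSᵣ ∧ 0 ≤ (((NYᵣ : ℕ) : ℤ) + 1) * ((Rᵣ : ℕ) : ℤ) ∧
      Apᵣ = ((nᵣ : ℕ) : ℤ) - vᵣ + ((WYᵣ : ℕ) : ℤ) + (((NYᵣ : ℕ) : ℤ) + 1) * ((Rᵣ : ℕ) : ℤ) ∧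
      Amᵣ = ((nᵣ : ℕ) : ℤ) + vᵣ + ((WYᵣ : ℕ) : ℤ) + (((NYᵣ : ℕ) : ℤ) + 1) * ((Rᵣ : ℕ) : ℤ) ∧
      kgC₂Y nᵣ ℓᵣ hᵣ vᵣ Rᵣ 0 qYᵣ WYᵣ NYᵣ m1ᵣ Wp2ᵣ 0 = (((NYᵣ : ℕ) : ℤ) + 1) * vᵣ + Apᵣ + ((((m1ᵣ : ℕ) : ℤ)) + 1) * (((Rᵣ : ℕ) : ℤ) + ((0 : ℕ) : ℤ)) - ((Wp2ᵣ : ℕ) : ℤ) := by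
  obtain ⟨hsc0, hsc1, hn1, hA0, hDp, hm, -, -, hkq, -⟩ := hsc_Q κ Φ t p D g f hN
  obtain ⟨hnR', hs40, hbig, hR1, hK40, -⟩ := valsQ_floor κ Φ t p D g f mk hN hg hg2
  have hUs := UsL_le_modulus κ Φ t p D g f hN
  have hNle : ((NYᵣ : ℕ) : ℤ) ≤ 21 * Kᵣ + 2 := by exact_mod_cast kgNYv0_le κ Φ t p D g f mk (qxYQ4 κ Φ t p D g f) (WxYQ4 κ Φ t p D g f) hN hg
  have H := kgYRows0_of κ Φ t p D g f mk (qxYQ4 κ Φ t p D g f) (WxYQ4 κ Φ t p D g f) hN hg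
  obtain ⟨-, -, hE3⟩ := H.kgE₁Y_spec NYᵣ
  obtain ⟨hnv1, hnv2⟩ := H.toNat_eq
  have hv := hN.v_le
  have hd1eq := (dec₁Y_eq_Q κ Φ t p D g f mk).1
  have hWY := WY_eq_3 κ Φ t p D g f
  obtain ⟨-, ha1⟩ := a1Y_bounds_3 κ Φ t p D g f mk hKq hN hg hg2 NYᵣ hNle
  obtain ⟨-, ha2⟩ := a2Y_le_3 κ Φ t p D g f mk hKq hN hg hg2 NYᵣ hNle
  have hsum : (((Wm2ᵣ : ℕ) : ℤ)) + ((Wp2ᵣ : ℕ) : ℤ) = ((kgE₁Y nᵣ vᵣ Rᵣ 0 WYᵣ NYᵣ : ℕ) : ℤ) := by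
    exact_mod_cast Skelφ.kgWm₂Y_add_kgWp₂Y (n := nᵣ) (v := vᵣ) (R' := Rᵣ) (ρ := 0) (W := WYᵣ) NYᵣ
  have hq := kgqY_qxYQ4 κ Φ t p D g f hN
  have hP0 := kgSL_le_natDiv κ Φ t p D g f hN
  have hP1 := Skelφ.natDiv_le_kgSLY hn1 ℓᵣ hᵣ
  have hP0nat : ((nᵣ * ℓᵣ / Uᵣ : ℕ) : ℤ) = P0ᵣ := by push_cast; rfl
  rw [hP0nat] at hP0 hP1 hq
  rw [kgSLY_eq_kgSL] at hP1
  have hdS : dSᵣ ≤ 2 := by exact_mod_cast Skelφ.dS_le_two _ _ _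
  have hUn : 0 < Uᵣ := by unfold Skelφ.shearUnit; omega
  have h3L : ((3 * (nᵣ * ℓᵣ) / Uᵣ : ℕ) : ℤ) ≤ ((3 * (nᵣ * ℓᵣ / Uᵣ) + 2 : ℕ) : ℤ) := by exact_mod_cast Skelφ.natDiv_three_le (nᵣ * ℓᵣ) Uᵣ hUn
  have h80 : 80 ≤ Neg.K κ := by have := Neg.K_eq κ; omega
  have hK80 : (80 : ℤ) ≤ Kᵣ := by exact_mod_cast h80
  have hKq' : Kᵣ = 40 * kqᵣ := by exact_mod_cast Neg.K_eq κ
  have hkqK : ((5 : ℕ) : ℤ) ≤ kqᵣ := by exact_mod_cast hKq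
  have hkq2 : (5 : ℤ) ≤ kqᵣ := by push_cast at hkqK; linarith
  have hRR : ((KS0.R'0 κ Φ t p D mk : ℕ) : ℤ) = ((Rᵣ : ℕ) : ℤ) := rfl
  rw [hRR] at hnR' hR1 hs40
  have hR0 : (0 : ℤ) ≤ ((Rᵣ : ℕ) : ℤ) := by linarith
  have hNR : (((NYᵣ : ℕ) : ℤ) + 1) * ((Rᵣ : ℕ) : ℤ) ≤ (21 * Kᵣ + 3) * ((Rᵣ : ℕ) : ℤ) := mul_le_mul_of_nonneg_right (by linarith) hR0
  have h21 : (21 * Kᵣ + 3) * ((Rᵣ : ℕ) : ℤ) ≤ 40 * Kᵣ * ((Rᵣ : ℕ) : ℤ) := mul_le_mul_of_nonneg_right (by linarith) hR0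
  have h105 : 241 * ((Rᵣ : ℕ) : ℤ) ≤ 40 * Kᵣ * ((Rᵣ : ℕ) : ℤ) := mul_le_mul_of_nonneg_right (by linarith) hR0
  have hKKR : Kᵣ ≤ Kᵣ * ((Rᵣ : ℕ) : ℤ) := le_mul_of_one_le_right (by linarith) hR1
  have hU : (0 : ℤ) < (Uᵣ : ℕ) := Skelφ.shearUnit_pos hn1 _
  have hΔU : Δᵣ ≤ ((Uᵣ : ℕ) : ℤ) * sLᵣ + 2 * ((Uᵣ : ℕ) : ℤ) := by
    have hmod := (Skelφ.NegPrm.modulus_vβOf hn1 hᵣ ℓᵣ vᵣ).2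
    have hvβ : vβL κ Φ t p D g f = Skelφ.NegPrm.vβOf nᵣ hᵣ ℓᵣ vᵣ := rfl
    rw [← hvβ] at hmod
    have hfl := Int.lt_mul_ediv_self_add (x := ((nᵣ : ℕ) : ℤ) * ℓᵣ - (Uᵣ : ℕ) + 1) hU
    unfold Skelφ.kgSL; linarith
  have hr0 : r0ᵣ = 40 * kqᵣ * s0ᵣ := by
    rw [PCells2.r_eq, show ((fcellsA κ Φ t p D g f).K : ℤ) = Neg.K κ by exact_mod_cast (fcellsA_K κ Φ t p D g f).1, show (Neg.K κ : ℤ) = 40 * kqᵣ from hKq']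
  have hr1 : r1ᵣ = 40 * kqᵣ * s1ᵣ := by
    rw [PCells2.r_eq, show ((fcellsA κ Φ t p D g f).K : ℤ) = Neg.K κ by exact_mod_cast (fcellsA_K κ Φ t p D g f).1, show (Neg.K κ : ℤ) = 40 * kqᵣ from hKq']
  have hs0 : (1 : ℤ) ≤ s0ᵣ := by exact_mod_cast (fcellsA κ Φ t p D g f).hs 0
  have hs1 : (1 : ℤ) ≤ s1ᵣ := by exact_mod_cast (fcellsA κ Φ t p D g f).hs 1
  have hAp : Apᵣ = ((nᵣ : ℕ) : ℤ) - vᵣ + ((WYᵣ : ℕ) : ℤ) + (((NYᵣ : ℕ) : ℤ) + 1) * ((Rᵣ : ℕ) : ℤ) := by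
    unfold Skelφ.kgA₁Yp; push_cast; rw [hnv2]
  have hAm : Amᵣ = ((nᵣ : ℕ) : ℤ) + vᵣ + ((WYᵣ : ℕ) : ℤ) + (((NYᵣ : ℕ) : ℤ) + 1) * ((Rᵣ : ℕ) : ℤ) := by
    unfold Skelφ.kgA₁Ym; push_cast; rw [hnv1]
  have hC2 : kgC₂Y nᵣ ℓᵣ hᵣ vᵣ Rᵣ 0 qYᵣ WYᵣ NYᵣ m1ᵣ Wp2ᵣ 0 = (((NYᵣ : ℕ) : ℤ) + 1) * vᵣ + Apᵣ + ((((m1ᵣ : ℕ) : ℤ)) + 1) * (((Rᵣ : ℕ) : ℤ) + ((0 : ℕ) : ℤ)) - ((Wp2ᵣ : ℕ) : ℤ) := by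
    rw [Skelφ.kgC₂Y_zero]; simp only [ChainPara.ParkPrm.aHi, Skelφ.kgPark₁Y, Skelφ.xParkPrmW]; push_cast; ring
  refine ⟨by linarith, hbig, hUs, hΔU, by exact_mod_cast hn1, hv, hkq2, hs0, hs1, hr0, hr1, by linarith, by linarith, by linarith, hWY, hnv1, hnv2,
    by linarith, ?_, hP0, hP1, hdS, ha1, ha2, by linarith, by linarith, by linarith, by linarith, hKq', hR0, rfl,
    (abs_le.1 hv).2, by linarith [(abs_le.1 hv).1], mul_le_mul_of_nonneg_left hdS (by positivity),
    by have : (0 : ℤ) ≤ 3 * (((nᵣ : ℕ) : ℤ) * ℓᵣ) / (Uᵣ : ℕ) := Int.ediv_nonneg (by positivity) (by positivity)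
       linarith, by positivity, by positivity, hAp, hAm, hC2⟩
  push_cast at h3L ⊢
  linarith

/-- **RUN REGION `k ≤ N`**: the drift-following box of `kgCorrSchedY_region_run_box` and its four reading rows. [this work] -/
theorem regionY_run_W (κ : Consts) {V : Type} [DecidableEq V] [Countable V] {G : SimpleGraph V} [G.LocallyFinite] (Φ : PlanarSkeletonFrmFrom G) (t : V) (p : unitInterval) (D : Skelφ.StepI.DataNS V) (g : ℕ) (f : ℕ) (mk : ℕ) (hKq : 5 ≤ Neg.Kq κ) (hN : EqNumL κ Φ t p D g f) (hg : gFloorKG κ Φ t p D mk ≤ g) (hg2 : 40 * Neg.K κ * KS0.R'0 κ Φ t p D mk ≤ g)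
    {k : ℕ} (hk : k ≤ NYᵣ) :
    ∃ lo hi : Site 2, (SCHᵣ).region (k) ⊆ Finset.Icc lo hi ∧ (-(5 * r1ᵣ) + 1 ≤ rdLoᵣ lo hi 1 ∧ rdHiᵣ lo hi 1 ≤ 22 * r1ᵣ - 1) ∧
        (-(2 * r0ᵣ) + 1 ≤ rdLoᵣ lo hi 0 ∧ rdHiᵣ lo hi 0 ≤ 2 * r0ᵣ - 1) := by
  obtain ⟨hsc0, hsc1, hn1, hA0, hDp, hm, hc₀, -, hkq, -⟩ := hsc_Q κ Φ t p D g f hN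
  obtain ⟨hU1, h958, hUs, hΔU, hn1z, hv, hkq2, hs0, hs1, hr0, hr1, hN1, hNRn, hNRs, hWY, hnv1, hnv2, hq, h3L, hP0, hP1, hdS, ha1, ha2, hWsum, hR105n, hR105s, hK40s, hKq, hR0, hSLX, hv1, hv2, hNdS, hL0, hNd0, hNR0, hAp, hAm, hC2⟩ := regionY_facts_W κ Φ t p D g f mk hKq hN hg hg2
  have hkN : (k : ℤ) ≤ ((NYᵣ : ℕ) : ℤ) := by exact_mod_cast hk
  have hk0 : (0 : ℤ) ≤ (k : ℤ) := by positivity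
  have hkle : (k : ℤ) ≤ 840 * kqᵣ + 3 := by linarith
  have hkR : ((k : ℤ) + 1) * ((Rᵣ : ℕ) : ℤ) ≤ (((NYᵣ : ℕ) : ℤ) + 1) * ((Rᵣ : ℕ) : ℤ) := mul_le_mul_of_nonneg_right (by linarith) hR0
  have hkR0 : (0 : ℤ) ≤ ((k : ℤ) + 1) * ((Rᵣ : ℕ) : ℤ) := by positivity
  have hkP : (k : ℤ) * (P0ᵣ + 1) ≤ (k : ℤ) * (sLᵣ + 2) := mul_le_mul_of_nonneg_left (by linarith) hk0
  have hkP' : (k : ℤ) * sLᵣ ≤ (k : ℤ) * (P0ᵣ + 1) := mul_le_mul_of_nonneg_left (by linarith) hk0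
  have Blo0 : ((k : ℤ)) * vᵣ - 150 * ((nᵣ : ℕ) : ℤ) ≤ (k : ℤ) * vᵣ - (((((nᵣ : ℕ) : ℤ) + vᵣ).toNat + WYᵣ : ℕ) : ℤ) - ((k : ℤ) + 1) * (Rᵣ : ℕ) - (nᵣ : ℕ) := by
    push_cast; linarith only [hnv1, hWY, hkR, hNRn, hv1, hR0]
  have Bhi0 : (k : ℤ) * vᵣ + (((((nᵣ : ℕ) : ℤ) - vᵣ).toNat + WYᵣ : ℕ) : ℤ) + ((k : ℤ) + 1) * (Rᵣ : ℕ) + (nᵣ : ℕ) ≤ ((k : ℤ)) * vᵣ + 150 * ((nᵣ : ℕ) : ℤ) := by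
    push_cast; linarith only [hnv2, hWY, hkR, hNRn, hv2, hR0]
  have Blo1 : ((k : ℤ)) * sLᵣ - 26 * sLᵣ ≤ (k : ℤ) * sLᵣ - (qYᵣ : ℕ) - ((k : ℤ) + 1) * (Rᵣ : ℕ) - L3ᵣ := by
    push_cast; linarith only [hq, hP1, hkR, hNRs, h3L, h958, hR0]
  have Blh : (k : ℤ) * sLᵣ - (qYᵣ : ℕ) - ((k : ℤ) + 1) * (Rᵣ : ℕ) - L3ᵣ ≤
      (k : ℤ) * (P0ᵣ + 1) + (qYᵣ : ℕ) + ((k : ℤ) + 1) * (Rᵣ : ℕ) + L3ᵣ := by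
    push_cast; linarith only [hkP', hq, hP0, h958, hL0, hkR0]
  have Bhi1 : (k : ℤ) * (P0ᵣ + 1) + (qYᵣ : ℕ) + ((k : ℤ) + 1) * (Rᵣ : ℕ) + L3ᵣ ≤ ((k : ℤ)) * sLᵣ + 2 * ((k : ℤ)) + 26 * sLᵣ := by
    push_cast; linarith only [hkP, hq, hP1, hkR, hNRs, h3L, h958, hR0]
  refine ⟨![(k : ℤ) * vᵣ - (((((nᵣ : ℕ) : ℤ) + vᵣ).toNat + WYᵣ : ℕ) : ℤ) - ((k : ℤ) + 1) * (Rᵣ : ℕ) - (nᵣ : ℕ),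
      (k : ℤ) * sLᵣ - (qYᵣ : ℕ) - ((k : ℤ) + 1) * (Rᵣ : ℕ) - L3ᵣ],
    ![(k : ℤ) * vᵣ + (((((nᵣ : ℕ) : ℤ) - vᵣ).toNat + WYᵣ : ℕ) : ℤ) + ((k : ℤ) + 1) * (Rᵣ : ℕ) + (nᵣ : ℕ),
      (k : ℤ) * (P0ᵣ + 1) + (qYᵣ : ℕ) + ((k : ℤ) + 1) * (Rᵣ : ℕ) + L3ᵣ], ?_, ?_⟩
  · intro y hy
    obtain ⟨h1, h2, h3, h4⟩ := Skelφ.kgCorrSchedY_region_run_box (HKᵣ).hn (HKᵣ).hv (HKᵣ).hlay ((HKᵣ).kgYVals_ok₁ NYᵣ) ((HKᵣ).kgYVals_ok₂ NYᵣ) ((HKᵣ).kgYVals_split NYᵣ) hk hy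
    rw [Finset.mem_Icc, Pi.le_def, Pi.le_def, Fin.forall_fin_two, Fin.forall_fin_two]
    simp only [Matrix.cons_val_zero, Matrix.cons_val_one]
    exact ⟨⟨h3, h1⟩, h4, h2⟩
  · obtain ⟨C1, C2, C3, C4⟩ := regionY_core3 hU1 h958 hUs hΔU hn1z hv hkq2 hs0 hs1 hr0 hr1 hk0 hkle (by linarith) le_rfl Blo0 Bhi0 Blo1 Blh Bhi1
    exact ⟨⟨Skelφ.rdLo_one_geK (hD := hDp) (hm := hm) (hkq := hkq) (hsc1 := hsc1) C1, Skelφ.rdHi_one_leK (hD := hDp) (hm := hm) (hkq := hkq) (hsc1 := hsc1) C2⟩,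
      Skelφ.rdLo_zero_geK (hn := hn1) (hA := hA0) (hD := hDp) (hm := hm) (hc₀ := hc₀) (hkq := hkq) (hsc0 := hsc0) C3,
      Skelφ.rdHi_zero_leK (hn := hn1) (hD := hDp) (hm := hm) (hc₀ := hc₀) (hkq := hkq) (hsc0 := hsc0) C4⟩

/-- **ACROSS-PARKING REGION `N+1+j`, `j ≤ m₁Y`**: the box of `kgCorrSchedY_region_park₁_box` and its four reading rows. [this work] -/
theorem regionY_park₁_W (κ : Consts) {V : Type} [DecidableEq V] [Countable V] {G : SimpleGraph V} [G.LocallyFinite] (Φ : PlanarSkeletonFrmFrom G) (t : V) (p : unitInterval) (D : Skelφ.StepI.DataNS V) (g : ℕ) (f : ℕ) (mk : ℕ) (hKq : 5 ≤ Neg.Kq κ) (hN : EqNumL κ Φ t p D g f) (hg : gFloorKG κ Φ t p D mk ≤ g) (hg2 : 40 * Neg.K κ * KS0.R'0 κ Φ t p D mk ≤ g)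
    {j : ℕ} (hj : j ≤ m1ᵣ) :
    ∃ lo hi : Site 2, (SCHᵣ).region (NYᵣ + 1 + j) ⊆ Finset.Icc lo hi ∧ (-(5 * r1ᵣ) + 1 ≤ rdLoᵣ lo hi 1 ∧ rdHiᵣ lo hi 1 ≤ 22 * r1ᵣ - 1) ∧
        (-(2 * r0ᵣ) + 1 ≤ rdLoᵣ lo hi 0 ∧ rdHiᵣ lo hi 0 ≤ 2 * r0ᵣ - 1) := by
  obtain ⟨hsc0, hsc1, hn1, hA0, hDp, hm, hc₀, -, hkq, -⟩ := hsc_Q κ Φ t p D g f hN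
  obtain ⟨hU1, h958, hUs, hΔU, hn1z, hv, hkq2, hs0, hs1, hr0, hr1, hN1, hNRn, hNRs, hWY, hnv1, hnv2, hq, h3L, hP0, hP1, hdS, ha1, ha2, hWsum, hR105n, hR105s, hK40s, hKq, hR0, hSLX, hv1, hv2, hNdS, hL0, hNd0, hNR0, hAp, hAm, hC2⟩ := regionY_facts_W κ Φ t p D g f mk hKq hN hg hg2
  have hjm : (j : ℤ) ≤ ((m1ᵣ : ℕ) : ℤ) := by exact_mod_cast hj
  have hN0 : (0 : ℤ) ≤ ((NYᵣ : ℕ) : ℤ) + 1 := by positivity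
  have hjR : (j : ℤ) * ((Rᵣ : ℕ) : ℤ) ≤ 197 * ((Rᵣ : ℕ) : ℤ) := mul_le_mul_of_nonneg_right (by linarith) hR0
  have hj0' : (0 : ℤ) ≤ (j : ℤ) * ((Rᵣ : ℕ) : ℤ) := by positivity
  have Blo0 : ((((NYᵣ : ℕ) : ℤ) + 1)) * vᵣ - 150 * ((nᵣ : ℕ) : ℤ) ≤ (((NYᵣ : ℕ) : ℤ) + 1) * vᵣ - Amᵣ - 2 * (nᵣ : ℕ) - (Rᵣ : ℕ) := by
    linarith only [hAm, hWY, hv1, hNRn, hR105n, hR0]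
  have Bhi0 : (((NYᵣ : ℕ) : ℤ) + 1) * vᵣ + Apᵣ + (j : ℤ) * (((Rᵣ : ℕ) : ℤ) + ((0 : ℕ) : ℤ)) + (Rᵣ : ℕ) + (nᵣ : ℕ) ≤ ((((NYᵣ : ℕ) : ℤ) + 1)) * vᵣ + 150 * ((nᵣ : ℕ) : ℤ) := by
    push_cast; linarith only [hAp, hWY, hv2, hNRn, hjR, hR105n, hR0]
  have Blo1 : ((((NYᵣ : ℕ) : ℤ) + 1)) * sLᵣ - 26 * sLᵣ ≤ (((NYᵣ : ℕ) : ℤ) + 1) * sLᵣ - (((qYᵣ : ℕ) : ℤ) + (((NYᵣ : ℕ) : ℤ) + 1) * (Rᵣ : ℕ)) - (j : ℤ) * (((Rᵣ : ℕ) : ℤ) + ((0 : ℕ) : ℤ)) - (Rᵣ : ℕ) - L3ᵣ := by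
    push_cast; linarith only [hq, hP1, hNRs, hjR, hR105s, h3L, h958, hR0]
  have Blh : (((NYᵣ : ℕ) : ℤ) + 1) * sLᵣ - (((qYᵣ : ℕ) : ℤ) + (((NYᵣ : ℕ) : ℤ) + 1) * (Rᵣ : ℕ)) - (j : ℤ) * (((Rᵣ : ℕ) : ℤ) + ((0 : ℕ) : ℤ)) - (Rᵣ : ℕ) - L3ᵣ ≤
      (((NYᵣ : ℕ) : ℤ) + 1) * sLᵣ + (((qYᵣ : ℕ) : ℤ) + (((NYᵣ : ℕ) : ℤ) + 1) * (Rᵣ : ℕ) + (((NYᵣ : ℕ) : ℤ) + 1) * dSᵣ) + (j : ℤ) * (((Rᵣ : ℕ) : ℤ) + ((0 : ℕ) : ℤ)) + (Rᵣ : ℕ) + L3ᵣ := by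
    push_cast; linarith only [hj0', hNd0, hq, hP0, h958, hL0, hNR0, hR0]
  have Bhi1 : (((NYᵣ : ℕ) : ℤ) + 1) * sLᵣ + (((qYᵣ : ℕ) : ℤ) + (((NYᵣ : ℕ) : ℤ) + 1) * (Rᵣ : ℕ) + (((NYᵣ : ℕ) : ℤ) + 1) * dSᵣ) + (j : ℤ) * (((Rᵣ : ℕ) : ℤ) + ((0 : ℕ) : ℤ)) + (Rᵣ : ℕ) + L3ᵣ ≤ ((((NYᵣ : ℕ) : ℤ) + 1)) * sLᵣ + 2 * ((((NYᵣ : ℕ) : ℤ) + 1)) + 26 * sLᵣ := by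
    push_cast; linarith only [hq, hP1, hNRs, hNdS, hjR, hR105s, h3L, h958, hR0]
  refine ⟨![(((NYᵣ : ℕ) : ℤ) + 1) * vᵣ - Amᵣ - 2 * (nᵣ : ℕ) - (Rᵣ : ℕ),
      (((NYᵣ : ℕ) : ℤ) + 1) * sLᵣ - (((qYᵣ : ℕ) : ℤ) + (((NYᵣ : ℕ) : ℤ) + 1) * (Rᵣ : ℕ)) - (j : ℤ) * (((Rᵣ : ℕ) : ℤ) + ((0 : ℕ) : ℤ)) - (Rᵣ : ℕ) - L3ᵣ],
    ![(((NYᵣ : ℕ) : ℤ) + 1) * vᵣ + Apᵣ + (j : ℤ) * (((Rᵣ : ℕ) : ℤ) + ((0 : ℕ) : ℤ)) + (Rᵣ : ℕ) + (nᵣ : ℕ),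
      (((NYᵣ : ℕ) : ℤ) + 1) * sLᵣ + (((qYᵣ : ℕ) : ℤ) + (((NYᵣ : ℕ) : ℤ) + 1) * (Rᵣ : ℕ) + (((NYᵣ : ℕ) : ℤ) + 1) * dSᵣ) + (j : ℤ) * (((Rᵣ : ℕ) : ℤ) + ((0 : ℕ) : ℤ)) + (Rᵣ : ℕ) + L3ᵣ], ?_, ?_⟩
  · intro y hy
    obtain ⟨h1, h2, h3, h4⟩ := Skelφ.kgCorrSchedY_region_park₁_box (HKᵣ).hn (HKᵣ).hv (HKᵣ).hlay ((HKᵣ).kgYVals_ok₁ NYᵣ) ((HKᵣ).kgYVals_ok₂ NYᵣ) ((HKᵣ).kgYVals_split NYᵣ) hj hy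
    rw [Finset.mem_Icc, Pi.le_def, Pi.le_def, Fin.forall_fin_two, Fin.forall_fin_two]
    simp only [Matrix.cons_val_zero, Matrix.cons_val_one]
    exact ⟨⟨h3, h1⟩, h4, h2⟩
  · obtain ⟨C1, C2, C3, C4⟩ := regionY_core3 hU1 h958 hUs hΔU hn1z hv hkq2 hs0 hs1 hr0 hr1 hN0 hN1 (by linarith) le_rfl Blo0 Bhi0 Blo1 Blh Bhi1
    exact ⟨⟨Skelφ.rdLo_one_geK (hD := hDp) (hm := hm) (hkq := hkq) (hsc1 := hsc1) C1, Skelφ.rdHi_one_leK (hD := hDp) (hm := hm) (hkq := hkq) (hsc1 := hsc1) C2⟩,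
      Skelφ.rdLo_zero_geK (hn := hn1) (hA := hA0) (hD := hDp) (hm := hm) (hc₀ := hc₀) (hkq := hkq) (hsc0 := hsc0) C3,
      Skelφ.rdHi_zero_leK (hn := hn1) (hD := hDp) (hm := hm) (hc₀ := hc₀) (hkq := hkq) (hsc0 := hsc0) C4⟩

/-- **ALONG-PARKING REGION `N+1+m₁Y+1+j`, `j ≤ m₂Y`**: the box of `kgCorrSchedY_region_park₂_box` and its four reading rows. [this work] -/
theorem regionY_park₂_W (κ : Consts) {V : Type} [DecidableEq V] [Countable V] {G : SimpleGraph V} [G.LocallyFinite] (Φ : PlanarSkeletonFrmFrom G) (t : V) (p : unitInterval) (D : Skelφ.StepI.DataNS V) (g : ℕ) (f : ℕ) (mk : ℕ) (hKq : 5 ≤ Neg.Kq κ) (hN : EqNumL κ Φ t p D g f) (hg : gFloorKG κ Φ t p D mk ≤ g) (hg2 : 40 * Neg.K κ * KS0.R'0 κ Φ t p D mk ≤ g)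
    {j : ℕ} (hj : j ≤ m2ᵣ) :
    ∃ lo hi : Site 2, (SCHᵣ).region (NYᵣ + 1 + m1ᵣ + 1 + j) ⊆ Finset.Icc lo hi ∧ (-(5 * r1ᵣ) + 1 ≤ rdLoᵣ lo hi 1 ∧ rdHiᵣ lo hi 1 ≤ 22 * r1ᵣ - 1) ∧
        (-(2 * r0ᵣ) + 1 ≤ rdLoᵣ lo hi 0 ∧ rdHiᵣ lo hi 0 ≤ 2 * r0ᵣ - 1) := by
  obtain ⟨hsc0, hsc1, hn1, hA0, hDp, hm, hc₀, -, hkq, -⟩ := hsc_Q κ Φ t p D g f hN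
  obtain ⟨hU1, h958, hUs, hΔU, hn1z, hv, hkq2, hs0, hs1, hr0, hr1, hN1, hNRn, hNRs, hWY, hnv1, hnv2, hq, h3L, hP0, hP1, hdS, ha1, ha2, hWsum, hR105n, hR105s, hK40s, hKq, hR0, hSLX, hv1, hv2, hNdS, hL0, hNd0, hNR0, hAp, hAm, hC2⟩ := regionY_facts_W κ Φ t p D g f mk hKq hN hg hg2
  have hjm : (j : ℤ) ≤ ((m2ᵣ : ℕ) : ℤ) := by exact_mod_cast hj
  have hN0 : (0 : ℤ) ≤ ((NYᵣ : ℕ) : ℤ) + 1 := by positivity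
  have hva : 0 ≤ |vᵣ| := abs_nonneg _
  have hjR : (j : ℤ) * (((Rᵣ : ℕ) : ℤ) + 0 + |vᵣ|) ≤ 41 * (((Rᵣ : ℕ) : ℤ) + ((nᵣ : ℕ) : ℤ)) := mul_le_mul (by linarith) (by linarith) (by positivity) (by norm_num)
  have hj0' : (0 : ℤ) ≤ (j : ℤ) * (((Rᵣ : ℕ) : ℤ) + 0 + |vᵣ|) := by positivity
  have hjRb : (j : ℤ) * ((Rᵣ : ℕ) : ℤ) ≤ 41 * ((Rᵣ : ℕ) : ℤ) := mul_le_mul_of_nonneg_right (by linarith) hR0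
  have hjRb0 : (0 : ℤ) ≤ (j : ℤ) * ((Rᵣ : ℕ) : ℤ) := by positivity
  have hm1R : ((((m1ᵣ : ℕ) : ℤ)) + 1) * ((Rᵣ : ℕ) : ℤ) ≤ 198 * ((Rᵣ : ℕ) : ℤ) := mul_le_mul_of_nonneg_right ha1 hR0
  have hm1R0 : (0 : ℤ) ≤ ((((m1ᵣ : ℕ) : ℤ)) + 1) * ((Rᵣ : ℕ) : ℤ) := by positivity
  have hWm0 : (0 : ℤ) ≤ ((Wm2ᵣ : ℕ) : ℤ) := Nat.cast_nonneg _
  have hWp0 : (0 : ℤ) ≤ ((Wp2ᵣ : ℕ) : ℤ) := Nat.cast_nonneg _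
  have hC2' := hC2
  push_cast at hC2'
  have Blo0 : ((((NYᵣ : ℕ) : ℤ) + 1)) * vᵣ - 150 * ((nᵣ : ℕ) : ℤ) ≤ kgC₂Y nᵣ ℓᵣ hᵣ vᵣ Rᵣ 0 qYᵣ WYᵣ NYᵣ m1ᵣ Wp2ᵣ 0 - (Wm2ᵣ : ℕ) - (j : ℤ) * (((Rᵣ : ℕ) : ℤ) + ((0 : ℕ) : ℤ) + |vᵣ|) - (Rᵣ : ℕ) - (nᵣ : ℕ) := by
    push_cast; linarith only [hC2', hAp, hWY, hv1, hR0, hm1R0, hWsum, hWp0, hjR, hR105n, hN0, hNRn]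
  have Bhi0 : kgC₂Y nᵣ ℓᵣ hᵣ vᵣ Rᵣ 0 qYᵣ WYᵣ NYᵣ m1ᵣ Wp2ᵣ 0 + (Wp2ᵣ : ℕ) + (j : ℤ) * (((Rᵣ : ℕ) : ℤ) + ((0 : ℕ) : ℤ) + |vᵣ|) + (Rᵣ : ℕ) + (nᵣ : ℕ) ≤ ((((NYᵣ : ℕ) : ℤ) + 1)) * vᵣ + 150 * ((nᵣ : ℕ) : ℤ) := by
    push_cast; linarith only [hC2', hAp, hWY, hv2, hNRn, hm1R, hjR, hR105n, hR0, hWm0, hWsum]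
  have Blo1 : ((((NYᵣ : ℕ) : ℤ) + 1)) * sLᵣ - 26 * sLᵣ ≤ (((NYᵣ : ℕ) : ℤ) + 1) * sLᵣ - (((qYᵣ : ℕ) : ℤ) + (((NYᵣ : ℕ) : ℤ) + 1) * (Rᵣ : ℕ)) - (((m1ᵣ : ℕ) : ℤ) + 1) * (((Rᵣ : ℕ) : ℤ) + ((0 : ℕ) : ℤ)) - (P0ᵣ + 1) - (Rᵣ : ℕ) - L3ᵣ := by
    push_cast; linarith only [hq, hP1, hNRs, hm1R, hR105s, h3L, h958, hR0]
  have Blh : (((NYᵣ : ℕ) : ℤ) + 1) * sLᵣ - (((qYᵣ : ℕ) : ℤ) + (((NYᵣ : ℕ) : ℤ) + 1) * (Rᵣ : ℕ)) - (((m1ᵣ : ℕ) : ℤ) + 1) * (((Rᵣ : ℕ) : ℤ) + ((0 : ℕ) : ℤ)) - (P0ᵣ + 1) - (Rᵣ : ℕ) - L3ᵣ ≤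
      (((NYᵣ : ℕ) : ℤ) + 1) * sLᵣ + (((qYᵣ : ℕ) : ℤ) + (((NYᵣ : ℕ) : ℤ) + 1) * (Rᵣ : ℕ) + (((NYᵣ : ℕ) : ℤ) + 1) * dSᵣ) + (((m1ᵣ : ℕ) : ℤ) + 1) * (((Rᵣ : ℕ) : ℤ) + ((0 : ℕ) : ℤ)) + (j : ℤ) * (((Rᵣ : ℕ) : ℤ) + ((0 : ℕ) : ℤ)) + (Rᵣ : ℕ) + L3ᵣ := by
    push_cast; linarith only [hm1R0, hjRb0, hNd0, hq, hP0, h958, hL0, hNR0, hR0]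
  have Bhi1 : (((NYᵣ : ℕ) : ℤ) + 1) * sLᵣ + (((qYᵣ : ℕ) : ℤ) + (((NYᵣ : ℕ) : ℤ) + 1) * (Rᵣ : ℕ) + (((NYᵣ : ℕ) : ℤ) + 1) * dSᵣ) + (((m1ᵣ : ℕ) : ℤ) + 1) * (((Rᵣ : ℕ) : ℤ) + ((0 : ℕ) : ℤ)) + (j : ℤ) * (((Rᵣ : ℕ) : ℤ) + ((0 : ℕ) : ℤ)) + (Rᵣ : ℕ) + L3ᵣ ≤ ((((NYᵣ : ℕ) : ℤ) + 1)) * sLᵣ + 2 * ((((NYᵣ : ℕ) : ℤ) + 1)) + 26 * sLᵣ := by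
    push_cast; linarith only [hq, hP1, hNRs, hNdS, hm1R, hjRb, hR105s, h3L, h958, hR0]
  refine ⟨![kgC₂Y nᵣ ℓᵣ hᵣ vᵣ Rᵣ 0 qYᵣ WYᵣ NYᵣ m1ᵣ Wp2ᵣ 0 - (Wm2ᵣ : ℕ) - (j : ℤ) * (((Rᵣ : ℕ) : ℤ) + ((0 : ℕ) : ℤ) + |vᵣ|) - (Rᵣ : ℕ) - (nᵣ : ℕ),
      (((NYᵣ : ℕ) : ℤ) + 1) * sLᵣ - (((qYᵣ : ℕ) : ℤ) + (((NYᵣ : ℕ) : ℤ) + 1) * (Rᵣ : ℕ)) - (((m1ᵣ : ℕ) : ℤ) + 1) * (((Rᵣ : ℕ) : ℤ) + ((0 : ℕ) : ℤ)) - (P0ᵣ + 1) - (Rᵣ : ℕ) - L3ᵣ],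
    ![kgC₂Y nᵣ ℓᵣ hᵣ vᵣ Rᵣ 0 qYᵣ WYᵣ NYᵣ m1ᵣ Wp2ᵣ 0 + (Wp2ᵣ : ℕ) + (j : ℤ) * (((Rᵣ : ℕ) : ℤ) + ((0 : ℕ) : ℤ) + |vᵣ|) + (Rᵣ : ℕ) + (nᵣ : ℕ),
      (((NYᵣ : ℕ) : ℤ) + 1) * sLᵣ + (((qYᵣ : ℕ) : ℤ) + (((NYᵣ : ℕ) : ℤ) + 1) * (Rᵣ : ℕ) + (((NYᵣ : ℕ) : ℤ) + 1) * dSᵣ) + (((m1ᵣ : ℕ) : ℤ) + 1) * (((Rᵣ : ℕ) : ℤ) + ((0 : ℕ) : ℤ)) + (j : ℤ) * (((Rᵣ : ℕ) : ℤ) + ((0 : ℕ) : ℤ)) + (Rᵣ : ℕ) + L3ᵣ], ?_, ?_⟩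
  · intro y hy
    obtain ⟨h1, h2, h3, h4⟩ := Skelφ.kgCorrSchedY_region_park₂_box (HKᵣ).hn (HKᵣ).hv (HKᵣ).hlay ((HKᵣ).kgYVals_ok₁ NYᵣ) ((HKᵣ).kgYVals_ok₂ NYᵣ) ((HKᵣ).kgYVals_split NYᵣ) j hy
    rw [Finset.mem_Icc, Pi.le_def, Pi.le_def, Fin.forall_fin_two, Fin.forall_fin_two]
    simp only [Matrix.cons_val_zero, Matrix.cons_val_one]
    exact ⟨⟨h3, h1⟩, h4, h2⟩
  · obtain ⟨C1, C2, C3, C4⟩ := regionY_core3 hU1 h958 hUs hΔU hn1z hv hkq2 hs0 hs1 hr0 hr1 hN0 hN1 (by linarith) le_rfl Blo0 Bhi0 Blo1 Blh Bhi1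
    exact ⟨⟨Skelφ.rdLo_one_geK (hD := hDp) (hm := hm) (hkq := hkq) (hsc1 := hsc1) C1, Skelφ.rdHi_one_leK (hD := hDp) (hm := hm) (hkq := hkq) (hsc1 := hsc1) C2⟩,
      Skelφ.rdLo_zero_geK (hn := hn1) (hA := hA0) (hD := hDp) (hm := hm) (hc₀ := hc₀) (hkq := hkq) (hsc0 := hsc0) C3,
      Skelφ.rdHi_zero_leK (hn := hn1) (hD := hDp) (hm := hm) (hc₀ := hc₀) (hkq := hkq) (hsc0 := hsc0) C4⟩

/-- **THE y′-CORRIDOR's PER-REGION READING ROWS** (`hPR` of p5-g16's `HY` at the tuple of record): every region of `kgCorrSchedY` (at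
`HK := kgYRows0_of …`, `N := kgNYv0 …`) lies in a frame box reading inside `[−5r₁+1, 22r₁−1] × [−2r₀+1, 2r₀−1]`. [this work] -/
theorem hPRY_W (κ : Consts) {V : Type} [DecidableEq V] [Countable V] {G : SimpleGraph V} [G.LocallyFinite] (Φ : PlanarSkeletonFrmFrom G) (t : V) (p : unitInterval) (D : Skelφ.StepI.DataNS V) (g : ℕ) (f : ℕ) (mk : ℕ) (hKq : 5 ≤ Neg.Kq κ) (hN : EqNumL κ Φ t p D g f) (hg : gFloorKG κ Φ t p D mk ≤ g) (hg2 : 40 * Neg.K κ * KS0.R'0 κ Φ t p D mk ≤ g) :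
    ∀ k ≤ (SCHᵣ).N, ∃ lo hi : Site 2, (SCHᵣ).region k ⊆ Finset.Icc lo hi ∧ (-(5 * r1ᵣ) + 1 ≤ rdLoᵣ lo hi 1 ∧ rdHiᵣ lo hi 1 ≤ 22 * r1ᵣ - 1) ∧
        (-(2 * r0ᵣ) + 1 ≤ rdLoᵣ lo hi 0 ∧ rdHiᵣ lo hi 0 ≤ 2 * r0ᵣ - 1) := by
  intro k hk
  have hSN : (SCHᵣ).N = NYᵣ + 1 + m1ᵣ + 1 + m2ᵣ := (Skelφ.kgCorrSchedY_params _ _ _ _ _ _).1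
  rw [hSN] at hk
  rcases le_or_gt k NYᵣ with hk1 | hk1
  · exact regionY_run_W κ Φ t p D g f mk hKq hN hg hg2 hk1
  · rcases le_or_gt k (NYᵣ + 1 + m1ᵣ) with hk2 | hk2
    · obtain ⟨j, rfl⟩ : ∃ j, k = NYᵣ + 1 + j := ⟨k - (NYᵣ + 1), by omega⟩
      exact regionY_park₁_W κ Φ t p D g f mk hKq hN hg hg2 (by omega)
    · obtain ⟨j, rfl⟩ : ∃ j, k = NYᵣ + 1 + m1ᵣ + 1 + j := ⟨k - (NYᵣ + 1 + m1ᵣ + 1), by omega⟩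
      exact regionY_park₂_W κ Φ t p D g f mk hKq hN hg hg2 (by omega)

end RegionsY

end NegB

end PlanarSkeletonFrmFrom

end Summit.CriticalPhenomena.PercolationContinuityZ3.Theorems.Transplant

end
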